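import Summits.FinalStateConjecture.FinalStateConjecture.Theses.ZeroEnergyKerrOrBomb
import Summits.FinalStateConjecture.FinalStateConjecture.Theses.SwallowTheDatum
import Summits.FinalStateConjecture.FinalStateConjecture.Theorems.StationaryLimitReduction.Negative.KillShape
import Summits.FinalStateConjecture.FinalStateConjecture.Theorems.ZeroEnergyKerrOrBombSymplecticDualOfTheBombSig4
import Summits.FinalStateConjecture.FinalStateConjecture.Theorems.ZeroEnergyKerrOrBombStationaryLimitReductionKerrIsometryRigidityWave3EndMatching
import Summits.FinalStateConjecture.FinalStateConjecture.Theorems.ZeroEnergyKerrOrBombStationaryLimitReductionRecutCoveringJunctionCore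
import Summits.FinalStateConjecture.FinalStateConjecture.Theorems.ZeroEnergyKerrOrBombStationaryLimitReductionMoncriefDualityReductionWave3
import Summits.FinalStateConjecture.FinalStateConjecture.Theorems.ZeroEnergyKerrOrBombStationaryLimitReductionMoncriefFactsWave3
import Summits.FinalStateConjecture.FinalStateConjecture.Theorems.ZeroEnergyKerrOrBombStationaryLimitReductionDualModeEjectionWave3
import Summits.FinalStateConjecture.FinalStateConjecture.Theorems.ZeroEnergyKerrOrBombStationaryLimitReductionProbeUniversalityWave3
import Literature.Geometry.Lorentzian.KerrKillingAlgebraProofs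
import Literature.Geometry.Lorentzian.KerrBackwardsIsometryProofs
import Literature.Geometry.Lorentzian.SchwarzschildKillingAlgebraProofs
import Literature.Geometry.Lorentzian.LocalConstraintDeformation
import Literature.Geometry.Lorentzian.TameFamilyOffCompact
import Literature.Geometry.Lorentzian.TameGenericityLocalWindow

/-!
# Line `symplectic-dual-of-the-bomb` — crux `StationaryLimitReduction`
# (route ZeroEnergyKerrOrBomb, item stmt-FinalStateConjecture-10021): CHECKED SKELETON, reshape r7
# (the line carried to the RE-TYPED summit of 2026-08-16T21:18Z)

Crux (fixed, the route's): `StationaryLimitReduction : Prop := KerrOrBomb → FinalStateConjecture`.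

Idea (crux-idea card `Ideas/symplectic-dual-of-the-bomb.md`, ideator 2; triage r1 3/3 pass): at the stratum "the
admissible datum `D` settles down to a black-hole BOMB" of the exceptional set, the unstable eigendirection of the
saddle is REALISED BY COMPACTLY SUPPORTED VACUUM DATA: the coefficient of the bomb's growing mode in a kicked development
is the slice pairing of the kick with the DUAL MODE (conserved ADM symplectic current) on `Σ₀ = ι(X)`, where
transversality is Moncrief's splitting.

## Shape after reshape r7 (lead c5 = lineage 0 re-seat, sole lead, 2026-08-17T00:xxZ — 7 registered stubs)

WHY r7. At 21:18Z the summit was RE-TYPED (p126844, semantic-vacuity audit T2): genericity became the TAME notion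
`InitialDataSet.IsTameChristodoulouGeneric` (one fixed end, continuous mass, weighted continuity, IMMERSION at the base
point), `HasExhaustiveCharts` gained honest radii, the per-datum conclusion gained `RaysStayInClosure 𝒟 O` and
`IsFutureOriented d`. Kernel-checked consequences for this line (lead c5, 22:50–23:30Z): the registered r5 and the tree's
r6 composition died at `isChristodoulouGeneric_one_of_local`; the root vocabulary module `…OneLockedExplosionDefs`
(`summit_iff`) no longer elaborates (operator maintenance requested: audit:p85447 + repaired file as item evidence; a
prover may not mutate it — `theorems.append-only`); the CLOSED stub 1F `stub_chartTransferGeneral` (p121011) broke on the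
radii clause and was REPAIRED proof-only from this seat (p130371). r7 = r6 carried honestly to the re-typed summit:

* currency `SettlesDocWithT2 Q` (§0) := `SettlesDocWith' Q` + `RaysStayInClosure 𝒟 (O ∩ I⁻(docCharted d))` +
  `IsOrientationCompatible 𝒟 d` (orthochronous motions; late charts send `𝓑ᵢ`-future vectors that land `g_𝒟`-timelike
  to `τ_𝒟`-future ones; idem `∂₀` for the flat chart) — the two clauses the re-type added, as hypotheses on the settling
  geometry (T2 per-datum property `SummitPropertyT2`, read-back `summitT2_iff : FSC ↔ ∀ X, IsTameChristodoulouGeneric …`);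
* 1R: `stub_kerrIsometryResiduals` := F3 `KerrHorizonExtension` ∧ F4 `KerrAsymptoticRigidity` (r6, unprinted) ∧ NEW F5
  `Sig7.stub_kerrIdentificationFuture` (classical, M: the `T`-equivariant identification `Θ`, `c > 0`, maps Kerr's
  future field `V_{M,a}` to `𝓑`-future vectors); the three cited Killing-algebra / backwards-isometry facts of r6 are
  now THEOREMS of the tree (`…_holds`, p116586-proofs / p129316 / p127724) and are discharged in §3, no longer hypotheses;
* 1G-core `stub_recutJunctionCore` (r6, unchanged); 1F RE-OPENED as `stub_chartTransferT2` (= landed transfer + ray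
  clause + orientation; L); 2 `stub_nonSettlingCure` (lead; open problem) now concludes the TAME IMMERSED witness shape;
  3 `stub_probeUniversality` (Bridge, unchanged); 4-residuals `stub_moncriefResiduals` := cited fact `ChruscielDelay_localConstraintDeformation` ∧ `LocalSingleDetectionAt` (r6 residual); 5 `stub_dualModeEjection`
  over the T2 currency with an IMMERSED steering curve (tameness derived in §3 from compact support).
* composition (§4): `KerrOrBomb` consumed three times as before; hypotheses = `MGHDExists` (stmt-9937, by name) + the 7 stubs; concludes the crux BY NAME over `IsTameChristodoulouGeneric` through the window lemma
  `isTameChristodoulouGeneric_of_localWindow` (Literature, p130530, this seat).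

## Earlier shapes (r1 → r6)

See the tree history of this file (r6: lead a2, 21:18Z; r5 20:00Z; r4 a1 19:30Z; r3; r2; r1 lead 1 10:32Z) and
`Cruxes/StationaryLimitReduction/PICKED.md`. The composition has been DATUM-WISE since r1 (Disproof §5 ∧-non-closure).
-/

noncomputable section

set_option linter.dupNamespace false
set_option maxSynthPendingDepth 3

open scoped Manifold ContDiff Topology BigOperators
open Set Filter Bundle MeasureTheory Literature.Geometry.Lorentzian
open Summit.FinalStateConjecture.FinalStateConjecture.Theses.ZeroEnergyKerrOrBomb

namespace Summit.FinalStateConjecture.FinalStateConjecture.Cruxes.StationaryLimitReduction.SymplecticDualOfTheBomb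

-- landed vocabulary: sibling Defs (p85447) and this line's Defs/Defs2/Sig/Sig4 + helper files
open Summit.FinalStateConjecture.FinalStateConjecture.Theorems.OneLockedExplosion
open Summit.FinalStateConjecture.FinalStateConjecture.Theorems.SymplecticDualOfTheBomb

/-! ## §0 Vocabulary of reshape r7 — INLINED copy of `Theorems/ZeroEnergyKerrOrBombSymplecticDualOfTheBombSig7.lean` (submitted;
the line's build lane is blocked behind the broken root module, so the workfile cannot import it yet; byte-identical bodies) -/

section Summit

variable (X : Type) [TopologicalSpace X] [ChartedSpace E3 X] [IsManifold (𝓡 3) ∞ X]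
  [T2Space X] [SecondCountableTopology X] [ConnectedSpace X]

/-- The property the RE-TYPED summit asserts generically of an admissible datum `D` on `X` — VERBATIM the lambda of
`FinalStateConjecture` after p126844 (so that `summitT2_iff` is `Iff.rfl`): an MGHD exists, and every MGHD has complete
`𝓘⁺` and a sub-extremal `N`-Kerr final-state decomposition `d` of its self-determined exterior `O` such that every
future-complete normalised null ray from the data stays in `closure O`, the charts exhaust `O` (honest radii), and chart
time is future-oriented. The pre-re-type lambda is `OneLockedExplosion.SummitProperty`. [cite: DafermosLuk2017, Conjecture 1 and §1.2.1] -/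
def SummitPropertyT2 (D : InitialDataSet (𝓡 3) X) : Prop :=
  (∃ 𝒟 : VacuumCauchyDevelopment D, 𝒟.IsMaximal) ∧
    ∀ 𝒟 : VacuumCauchyDevelopment D, 𝒟.IsMaximal →
      Summit.FinalStateConjecture.HasCompleteNullInfinity 𝒟.toCauchyDevelopment ∧
        ∃ (O : Set 𝒟.carrier) (d : FinalStateDecomposition 𝒟.toSpacetime O 2),
          (∀ i, Kerr.IsSubextremal (d.mass i) (d.spin i)) ∧
            O = Summit.FinalStateConjecture.exteriorOf 𝒟.toCauchyDevelopment d.charted ∧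
              Summit.FinalStateConjecture.RaysStayInClosure 𝒟.toCauchyDevelopment O ∧
                Summit.FinalStateConjecture.HasExhaustiveCharts d ∧
                  Summit.FinalStateConjecture.IsFutureOriented d

omit [T2Space X] [SecondCountableTopology X] in
/-- The re-typed per-datum property implies the pre-re-type one (forget the ray clause and the orientation clause).
[folklore] -/
theorem summitPropertyT2_imp {D : InitialDataSet (𝓡 3) X} (h : SummitPropertyT2 X D) : SummitProperty X D := by
  refine ⟨h.1, fun 𝒟 h𝒟 ↦ ?_⟩
  obtain ⟨hcni, O, d, hsub, hO, -, hex, -⟩ := h.2 𝒟 h𝒟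
  exact ⟨hcni, O, d, hsub, hO, hex⟩

end Summit

/-- The re-typed summit unfolded through `SummitPropertyT2` (definitional): TAME Christodoulou genericity of
`SummitPropertyT2` in the admissible class, on every slice. Registration device of this module. [folklore] -/
theorem summitT2_iff :
    _root_.FinalStateConjecture ↔
      ∀ (X : Type) [TopologicalSpace X] [ChartedSpace E3 X] [IsManifold (𝓡 3) ∞ X] [T2Space X]
        [SecondCountableTopology X] [ConnectedSpace X],
        InitialDataSet.IsTameChristodoulouGeneric (admissibleVacuumData X) (SummitPropertyT2 X) 1 :=
  Iff.rfl

section Orientation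

variable {X : Type} [TopologicalSpace X] [ChartedSpace E3 X] [IsManifold (𝓡 3) ∞ X]
  [ConnectedSpace X] {D : InitialDataSet (𝓡 3) X}

/-- **The settling charts respect the time orientations** (r7; the clause the re-typed summit's `IsFutureOriented` needs
on the input side of the chart transfer). (i) Every asymptotic motion `Λᵢ` is orthochronous. (ii) For every hole `i`,
every LATE point `y` of the moved adapted background (rest-frame chart time `> τ₀`) and every `w : E4`: if the rest-frame vector `Λᵢ⁻¹ w`, pushed by the
adapted chart `Aᵢ` at `Λᵢ⁻¹(y − cᵢ)`, is FUTURE-directed for `𝓑ᵢ`, and the push-forward of `w` by the late chart `ψᵢ`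
at `y` is timelike for `g_𝒟`, then that push-forward is future-directed for `(g_𝒟, τ_𝒟)`. (iii) Wherever, at a late
point (`x⁰ > τ₀`), the flat chart pushes `∂₀` to a `g_𝒟`-timelike vector, that vector is future-directed. These are statements about the SIGN only
(future rather than past); that the relevant push-forwards are eventually timelike follows from the `C²` convergence on
the certified slabs and is not asserted here. Honest decompositions (charts read off a time function of `𝒟`) satisfy it
exactly; Kerr's own development with Kerr–Schild charts satisfies it. (ref: ONeill1983, Ch. 5 p. 145; DafermosLuk2017,
Conjecture 1) [cite: ONeill1983, Ch. 5  p. 145] -/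
def IsOrientationCompatible (𝒟 : VacuumCauchyDevelopment D) {O : Set 𝒟.carrier} {k : ℕ}
    (d : StationaryFinalStateDecomposition 𝒟.toSpacetime O k) : Prop :=
  (∀ i, Summit.FinalStateConjecture.IsOrthochronous (d.motion i).1) ∧
  (∀ (i : Fin d.N) (y : (d.background i).domain) (w : E4), d.toOver.τ₀ < (d.background i).time y.1 →
    (d.hole i).timeOrientation.IsFutureDirected
        (mfderiv 𝓘(ℝ, E4) (𝓡 4) (d.adapted i).toFun
          ⟨poincareInv (d.motion i).1 (d.motion i).2 y.1, ModelBackground.mem_boost_domain.1 y.2⟩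
          (((d.motion i).1 : E4 ≃L[ℝ] E4).symm w)) →
      𝒟.metric.IsTimelike (mfderiv 𝓘(ℝ, E4) (𝓡 4) (d.toOver.chart i) y w) →
        𝒟.timeOrientation.IsFutureDirected (mfderiv 𝓘(ℝ, E4) (𝓡 4) (d.toOver.chart i) y w)) ∧
  ∀ y : d.toOver.flatDomain, d.toOver.τ₀ < (y : E4) 0 →
    𝒟.metric.IsTimelike (mfderiv 𝓘(ℝ, E4) (𝓡 4) d.toOver.flatChart y (E4.basisVector 0)) →
      𝒟.timeOrientation.IsFutureDirected (mfderiv 𝓘(ℝ, E4) (𝓡 4) d.toOver.flatChart y (E4.basisVector 0))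

end Orientation

/-- **"Every MGHD of `D` settles down to regular stationary vacuum holes with property `Q`", T2 form** — the r4/r5
currency `SettlesDocWith' Q` (complete `𝓘⁺`; a `C²` stationary decomposition of the honest exterior
`O = exteriorOf 𝒟 d.charted`, exhaustive in the d.o.c. sense `HasExhaustiveDocCharts'`, horizon-normalised; regular
Kerr-chartable holes in the telescope, `I⁺`-regular, with property `Q`) PLUS the two clauses of the re-typed summit, as
hypotheses on the settling geometry: every future-complete normalised null ray from the data stays in the closure of the
self-determined d.o.c. `O ∩ I⁻(docCharted d)` (`RaysStayInClosure`), and the charts respect the time orientations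
(`IsOrientationCompatible`). [cite: DafermosLuk2017, §1.2.1 and Conjecture 1] -/
def SettlesDocWithT2 (Q : StationaryAFBlackHole.{0} → Prop) (X : Type) [TopologicalSpace X]
    [ChartedSpace E3 X] [IsManifold (𝓡 3) ∞ X] [T2Space X] [SecondCountableTopology X]
    [ConnectedSpace X] (D : InitialDataSet (𝓡 3) X) : Prop :=
  ∀ 𝒟 : VacuumCauchyDevelopment D, 𝒟.IsMaximal →
    Summit.FinalStateConjecture.HasCompleteNullInfinity 𝒟.toCauchyDevelopment ∧
      ∃ (O : Set 𝒟.carrier) (d : StationaryFinalStateDecomposition 𝒟.toSpacetime O 2),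
        O = Summit.FinalStateConjecture.exteriorOf 𝒟.toCauchyDevelopment d.charted ∧
          HasExhaustiveDocCharts' d ∧ IsHorizonNormalised d ∧
            Summit.FinalStateConjecture.RaysStayInClosure 𝒟.toCauchyDevelopment
              (O ∩ 𝒟.metric.chronologicalPast 𝒟.timeOrientation (docCharted d)) ∧
              IsOrientationCompatible 𝒟 d ∧
                ∀ i, (d.hole i).horizon ⊆ Set.range (d.adapted i).toFun ∧
                  ChartIsAsymptoticallyCartesian (d.adapted i) ∧
                    ChartIsAsymptoticallySchwarzschildean' (d.adapted i) ∧
                      InTelescope (d.hole i) ∧ (d.hole i).IsIPlusRegular ∧ Q (d.hole i)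

/-! ## §1 The restated / new stub statements of reshape r7 (precise `Prop`s `Sig7.stub_<name>`; inlined copy) -/

/-- **Stub 1R-F5 · `kerrIdentificationFuture` (NEW, classical, re-type-forced)** — the Kerr identification of a telescope
hole is future-preserving: if `Θ` is a `T`-equivariant (`Θ(x + s e₀) = Θ x + (c s) e₀`, `c > 0`) isometric identification
of the Kerr exterior `(Kerr.exterior M a, Kerr.bilin M a)` with the d.o.c. part of the adapted chart `A`
(`IsKerrChartedWith`), then at every point of the Kerr exterior the push-forward by `A ∘ Θ` of Kerr's future timelike
field `V_{M,a} = −g♯(dt*)` (`Kerr.timeVector`) is future-directed for `𝓑`. WHY TRUE: `dA(e₀) = T` is future timelike on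
`M_ext ⊆ doc` (structure field `isStationary`), so at a point of `Θ⁻¹(A⁻¹ M_ext)` the `A`-timelike vectors `dΘ(V)` and
`dΘ(e₀) = c e₀` lie in one cone (`g_{M,a}(V, e₀) = −1`, `Θ` isometric), whence `dA(dΘ V)` is future there; a continuous
nowhere-null timelike field on the connected `Kerr.exterior` cannot change cone. SIZE: M. (ref: ONeill1983, Ch. 5
Lemma 5.26 ff.; ChruscielCosta2008, §2.2) -/
def Sig7.stub_kerrIdentificationFuture : Prop :=
  ∀ (𝓑 : StationaryAFBlackHole.{0}) (A : 𝓑.AdaptedChart) (M a c r₀ : ℝ) (Θ : E4 → E4),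
    InTelescope 𝓑 → IsKerrChartedWith 𝓑 A M a c r₀ Θ →
      ∀ u ∈ (Kerr.exterior M a : Set E4), ∀ h : Θ u ∈ A.domain,
        𝓑.timeOrientation.IsFutureDirected
          (mfderiv 𝓘(ℝ, E4) (𝓡 4) A.toFun ⟨Θ u, h⟩ (fderiv ℝ Θ u (Kerr.timeVector M a u)))

/-- **Stub 1F-T2 · `chartTransferT2` (stub 1F RE-OPENED by the re-type)** — the chart transfer in general position with
the re-typed summit's per-datum conclusion: for a `C²` stationary decomposition `d` of the honest exterior
`O = exteriorOf 𝒟 d.charted`, exhaustive in the d.o.c. sense, horizon-normalised, with Kerr identifications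
`IsKerrChartedWith` of its holes which are future-preserving (conclusion of `Sig7.stub_kerrIdentificationFuture`), the
covering clauses of the naive recut (`KerrSchildRecutCovering`), complete rays staying in the closure of the
self-determined d.o.c., and orientation-compatible charts, there is a sub-extremal Kerr–Schild `FinalStateDecomposition d'`
of `O' = exteriorOf 𝒟 d'.charted` with `RaysStayInClosure 𝒟 O'`, exhaustive charts (honest radii) and future-oriented
chart time. The first three conjuncts are the landed `stub_chartTransferGeneral` (p121011; radii repaired p130371); the
ray clause transfers because `O ∩ I⁻(docCharted d) ⊆ O'` (every point of the self-determined d.o.c. is in the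
chronological past of the recut late images: `HasExhaustiveDocCharts'` (ii) at a late time + `Θ '' Kerr.exterior = A⁻¹ doc`
+ the tilt bound); `IsFutureOriented d'` from orthochronous motions, `IsOrientationCompatible`, future-preservation of
`Θᵢ`, and eventual timelikeness of the push-forwards of `Λᵢ V` / `∂₀` (from the `C²` convergence on the certified slabs,
`g_{M,a}(V, V) = −1 − 2H ≤ −1`). SIZE: L (the recut proof of p121011 re-run with three more outputs). (ref:
DafermosLuk2017, Conjecture 1 (b)–(c)) -/
def Sig7.stub_chartTransferT2 : Prop :=
  ∀ (X : Type) [TopologicalSpace X] [ChartedSpace E3 X] [IsManifold (𝓡 3) ∞ X]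
    [T2Space X] [SecondCountableTopology X] [ConnectedSpace X] (D : InitialDataSet (𝓡 3) X)
    (𝒟 : VacuumCauchyDevelopment D) (O : Set 𝒟.carrier)
    (d : StationaryFinalStateDecomposition 𝒟.toSpacetime O 2)
    (M a c r₀ : Fin d.N → ℝ) (Θ : Fin d.N → E4 → E4),
    O = Summit.FinalStateConjecture.exteriorOf 𝒟.toCauchyDevelopment d.charted →
    HasExhaustiveDocCharts' d → IsHorizonNormalised d →
    (∀ i, IsKerrChartedWith (d.hole i) (d.adapted i) (M i) (a i) (c i) (r₀ i) (Θ i)) →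
    (∀ i, ∀ u ∈ (Kerr.exterior (M i) (a i) : Set E4), ∀ h : Θ i u ∈ (d.adapted i).domain,
      (d.hole i).timeOrientation.IsFutureDirected
        (mfderiv 𝓘(ℝ, E4) (𝓡 4) (d.adapted i).toFun ⟨Θ i u, h⟩
          (fderiv ℝ (Θ i) u (Kerr.timeVector (M i) (a i) u)))) →
    KerrSchildRecutCovering 𝒟 d M a Θ →
    Summit.FinalStateConjecture.RaysStayInClosure 𝒟.toCauchyDevelopment
      (O ∩ 𝒟.metric.chronologicalPast 𝒟.timeOrientation (docCharted d)) →
    IsOrientationCompatible 𝒟 d →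
    ∃ (O' : Set 𝒟.carrier) (d' : FinalStateDecomposition 𝒟.toSpacetime O' 2),
      (∀ i, Kerr.IsSubextremal (d'.mass i) (d'.spin i)) ∧
        O' = Summit.FinalStateConjecture.exteriorOf 𝒟.toCauchyDevelopment d'.charted ∧
          Summit.FinalStateConjecture.RaysStayInClosure 𝒟.toCauchyDevelopment O' ∧
            Summit.FinalStateConjecture.HasExhaustiveCharts d' ∧
              Summit.FinalStateConjecture.IsFutureOriented d'

/-- **Stub 2 · `nonSettlingCure` (r7: T2 currency, TAME IMMERSED witness)** — the global half: data that do not settle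
regularly IN THE T2 D.O.C. SENSE (`SettlesDocWithT2 ⊤`), or that settle with an MGHD carrying a local Killing germ at
EVERY point of the slice, are curable by a witness curve of the RE-TYPED genericity: an end `e`, a family `F` tame on `e`
(`IsTameDataFamily`: jointly smooth, `e` sole, Dafermos–Rodnianski flat with continuous mass, `wDist`-continuous at
`0`), immersed at `0`, injective, admissible, `F 0 = D`, all of whose members off `0` settle (T2 d.o.c. sense) to
MODE-STABLE regular holes. SIZE: open problem (weak cosmic censorship in Christodoulou's instability form + large-data
settling + a dynamical third law + `I⁺`-regularity and rates of the limits + the two T2 clauses + the curing of symmetric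
exceptional data) — owed by every stationary-limit line, kept as ONE curve statement (Disproof §5); `KerrOrBomb ⊢ crux ↔
summit` (p122022). (ref: DafermosLuk2017, §1.2.1; Christodoulou1999, p. A24) -/
def Sig7.stub_nonSettlingCure : Prop :=
  ∀ (X : Type) [TopologicalSpace X] [ChartedSpace E3 X] [IsManifold (𝓡 3) ∞ X]
    [T2Space X] [SecondCountableTopology X] [ConnectedSpace X],
    ∀ D ∈ admissibleVacuumData X,
      (¬ SettlesDocWithT2 (fun _ ↦ True) X D ∨
        ∃ 𝒟 : VacuumCauchyDevelopment D, 𝒟.IsMaximal ∧ ∀ x : X, ¬ IsKIDFreeAt 𝒟 x) →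
      ∃ (e : AFEnd X) (F : EuclideanSpace ℝ (Fin 1) → InitialDataSet (𝓡 3) X),
        InitialDataSet.IsTameDataFamily e 1 F ∧ InitialDataSet.IsImmersedAtZero 1 F ∧ F 0 = D ∧
          Function.Injective F ∧ (∀ c, F c ∈ admissibleVacuumData X) ∧
            ∀ c : EuclideanSpace ℝ (Fin 1), c ≠ 0 → SettlesDocWithT2 ModeStable X (F c)

/-- **Stub 5 · `dualModeEjection` (r7: T2 currency, IMMERSED steering curve)** — the symplectic dual of the bomb detects
at a germ-KID-free point, and transversal steerable families escape: for an admissible `D`, an MGHD with complete `𝓘⁺` and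
a `C²` stationary decomposition in the T2 d.o.c. sense (honest exterior, `HasExhaustiveDocCharts'`, horizon-normalised,
complete rays in the closure of the self-determined d.o.c., orientation-compatible charts, regular holes) whose hole `i`
carries a growing gravitational Killing-mode pair, and which HAS a germ-KID-free point: there are a germ-KID-free point
`x₀` and finitely many SYMMETRIC detectors at `x₀` such that every jointly smooth admissible `k`-family `G` through `D`
supported in the chart source at `x₀` with non-degenerate pairing matrix contains a jointly smooth curve `F`
(`F c = G c'`), IMMERSED at `0`, injective on a window `‖c‖ < ε`, all of whose members `0 < ‖c‖ < ε` settle (T2 d.o.c.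
sense) to MODE-STABLE regular holes. (Tameness of `F` is not asked: it follows from compact support,
`isTameDataFamily_restrict_of_agree_off_compact_one`.) Debts (all absent from print): dual-mode transport by the conserved
symplectic current, local non-gauge-ness of the dual mode, the saddle and the fate of the explosion. (ref:
DafermosLuk2017, §1.2.1; Christodoulou1999, p. A24) -/
def Sig7.stub_dualModeEjection : Prop :=
  ∀ (X : Type) [TopologicalSpace X] [ChartedSpace E3 X] [IsManifold (𝓡 3) ∞ X]
    [T2Space X] [SecondCountableTopology X] [ConnectedSpace X],
    ∀ D ∈ admissibleVacuumData X, ∀ (𝒟 : VacuumCauchyDevelopment D), 𝒟.IsMaximal →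
      Summit.FinalStateConjecture.HasCompleteNullInfinity 𝒟.toCauchyDevelopment →
      ∀ (O : Set 𝒟.carrier) (d : StationaryFinalStateDecomposition 𝒟.toSpacetime O 2),
        O = Summit.FinalStateConjecture.exteriorOf 𝒟.toCauchyDevelopment d.charted →
        HasExhaustiveDocCharts' d → IsHorizonNormalised d →
        Summit.FinalStateConjecture.RaysStayInClosure 𝒟.toCauchyDevelopment
          (O ∩ 𝒟.metric.chronologicalPast 𝒟.timeOrientation (docCharted d)) →
        IsOrientationCompatible 𝒟 d →
        (∀ i, (d.hole i).horizon ⊆ Set.range (d.adapted i).toFun ∧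
          ChartIsAsymptoticallyCartesian (d.adapted i) ∧
            ChartIsAsymptoticallySchwarzschildean' (d.adapted i) ∧
              InTelescope (d.hole i) ∧ (d.hole i).IsIPlusRegular) →
        ∀ (i : Fin d.N) (ν ϖ : ℝ) (h₁ h₂ : HoleBilinField (d.hole i)), 0 < ν →
          IsGravitationalModePair (d.hole i) (d.adapted i) ν ϖ h₁ h₂ →
          (∃ x : X, IsKIDFreeAt 𝒟 x) →
          ∃ (x₀ : X) (k : ℕ) (A B : Fin k → BilinField X), AreSymmDetectorsAt 𝒟 x₀ A B ∧
            ∀ G : EuclideanSpace ℝ (Fin k) → InitialDataSet (𝓡 3) X,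
              InitialDataSet.IsSmoothDataFamily k G → G 0 = D → (∀ c, G c ∈ admissibleVacuumData X) →
              (∃ K : Set X, IsCompact K ∧ K ⊆ (extChartAt (𝓡 3) x₀).source ∧ IsSupportedIn D G K) →
              (pairingMatrix D x₀ A B G).det ≠ 0 →
              ∃ (ε : ℝ) (F : EuclideanSpace ℝ (Fin 1) → InitialDataSet (𝓡 3) X), 0 < ε ∧
                InitialDataSet.IsSmoothDataFamily 1 F ∧ InitialDataSet.IsImmersedAtZero 1 F ∧ F 0 = D ∧
                (∀ c, ∃ c', F c = G c') ∧
                (∀ c c' : EuclideanSpace ℝ (Fin 1), ‖c‖ < ε → ‖c'‖ < ε → F c = F c' → c = c') ∧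
                ∀ c : EuclideanSpace ℝ (Fin 1), c ≠ 0 → ‖c‖ < ε → SettlesDocWithT2 ModeStable X (F c)

/-- **Stub 1R-residuals (r7 registration device)** — the conjunction of the three residual obligations of stub 1R:
F3 `KerrHorizonExtension` ∧ F4 `KerrAsymptoticRigidity` (r6, p125844, unprinted) ∧ F5 `Sig7.stub_kerrIdentificationFuture`
(new, classical). Registered as ONE stub (stubs_max); its conjuncts land separately as helpers. (ref: ChruscielCosta2008,
Thm. 1.3 and §4) -/
def Sig7.stub_kerrIsometryResiduals : Prop :=
  KerrHorizonExtension ∧ KerrAsymptoticRigidity ∧ Sig7.stub_kerrIdentificationFuture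

/-- **Stub 4-residuals (r7 registration device)** — the two obligations left of stub 4 (`Sig.stub_moncriefFacts`, via the
wave-3 reduction `stub_moncriefFacts_of_facts`, p124620): the CITED Literature fact
`ChruscielDelay_localConstraintDeformation` (local constraint deformation off germ-KIDs; Chruściel–Delay 2003 Thm. 5.9 /
Corvino–Schoen 2006 — a literature debt, closed by its `_holds` theorem and by nothing else) ∧ the localised Moncrief
annihilator lemma in single-detector form (`LocalSingleDetectionAt`, the r6 worker residual). (ref: ChruscielDelay2003,
Thm. 5.9; Moncrief1975, §IV) -/
def Sig7.stub_moncriefResiduals : Prop :=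
  Literature.Geometry.Lorentzian.ChruscielDelay_localConstraintDeformation ∧
    ∀ (X : Type) [TopologicalSpace X] [ChartedSpace E3 X] [IsManifold (𝓡 3) ∞ X] [T2Space X]
      [SecondCountableTopology X] [ConnectedSpace X] (D : InitialDataSet (𝓡 3) X)
      (𝒟 : VacuumCauchyDevelopment D) (x₀ : X), LocalSingleDetectionAt 𝒟 x₀

/-- **Stub 1G-core (r7 registration device)** — `RecutJunctionCore` (p125072) by name. (ref: DafermosLuk2017,
Conjecture 1 (b)–(c)) -/
def Sig7.stub_recutJunctionCore : Prop :=
  RecutJunctionCore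

/-! ### Read-backs and monotonicity of the inlined currency (sorry-free) -/

/-- Read-back of `SettlesDocWithT2` (definitional). [folklore] -/
theorem settlesDocWithT2_iff : ∀ (Q : StationaryAFBlackHole.{0} → Prop) (X : Type) [TopologicalSpace X] [ChartedSpace E3 X] [IsManifold (𝓡 3) ∞ X] [T2Space X] [SecondCountableTopology X] [ConnectedSpace X] (D : InitialDataSet (𝓡 3) X), SettlesDocWithT2 Q X D ↔ ∀ 𝒟 : VacuumCauchyDevelopment D, 𝒟.IsMaximal → Summit.FinalStateConjecture.HasCompleteNullInfinity 𝒟.toCauchyDevelopment ∧ ∃ (O : Set 𝒟.carrier) (d : StationaryFinalStateDecomposition 𝒟.toSpacetime O 2), O = Summit.FinalStateConjecture.exteriorOf 𝒟.toCauchyDevelopment d.charted ∧ HasExhaustiveDocCharts' d ∧ IsHorizonNormalised d ∧ Summit.FinalStateConjecture.RaysStayInClosure 𝒟.toCauchyDevelopment (O ∩ 𝒟.metric.chronologicalPast 𝒟.timeOrientation (docCharted d)) ∧ IsOrientationCompatible 𝒟 d ∧ ∀ i, (d.hole i).horizon ⊆ Set.range (d.adapted i).toFun ∧ ChartIsAsymptoticallyCartesian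 (d.adapted i) ∧ ChartIsAsymptoticallySchwarzschildean' (d.adapted i) ∧ InTelescope (d.hole i) ∧ (d.hole i).IsIPlusRegular ∧ Q (d.hole i) :=
  fun _ _ _ _ _ _ _ _ _ ↦ Iff.rfl

/-- `SettlesDocWithT2` is monotone in the hole property (used by the skeleton's `exists_bomb_docT2`). [folklore] -/
theorem settlesDocWithT2_mono : ∀ (Q Q' : StationaryAFBlackHole.{0} → Prop) (X : Type) [TopologicalSpace X] [ChartedSpace E3 X] [IsManifold (𝓡 3) ∞ X] [T2Space X] [SecondCountableTopology X] [ConnectedSpace X] (D : InitialDataSet (𝓡 3) X), (∀ 𝓑, Q 𝓑 → Q' 𝓑) → SettlesDocWithT2 Q X D → SettlesDocWithT2 Q' X D := by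
  intro Q Q' X _ _ _ _ _ _ D hQ h 𝒟 h𝒟
  obtain ⟨hcni, O, d, hO, hex, hnorm, hrays, hor, hholes⟩ := h 𝒟 h𝒟
  exact ⟨hcni, O, d, hO, hex, hnorm, hrays, hor, fun i ↦ ⟨(hholes i).1, (hholes i).2.1, (hholes i).2.2.1,
    (hholes i).2.2.2.1, (hholes i).2.2.2.2.1, hQ _ (hholes i).2.2.2.2.2⟩⟩

/-- The T2 currency forgets to the r4 currency `SettlesDocWith'` (drop the ray and orientation clauses). [folklore] -/
theorem SettlesDocWithT2.settlesDocWith' : ∀ (Q : StationaryAFBlackHole.{0} → Prop) (X : Type) [TopologicalSpace X] [ChartedSpace E3 X] [IsManifold (𝓡 3) ∞ X] [T2Space X] [SecondCountableTopology X] [ConnectedSpace X] (D : InitialDataSet (𝓡 3) X), SettlesDocWithT2 Q X D → SettlesDocWith' Q X D := by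
  intro Q X _ _ _ _ _ _ D h 𝒟 h𝒟
  obtain ⟨hcni, O, d, hO, hex, hnorm, -, -, hholes⟩ := h 𝒟 h𝒟
  exact ⟨hcni, O, d, hO, hex, hnorm, hholes⟩


/-! ## §2 Registered stubs of r7 (`sorry` lives ONLY here; 7 = stubs_max) -/

/-- Stub 1R-residuals (r7): F3 horizon extension ∧ F4 asymptotic rigidity (r6 residuals of p125844, unprinted) ∧ F5 the
future-preservation of the Kerr identification (new, classical). One registered obligation; conjuncts land separately. -/
theorem stub_kerrIsometryResiduals : Sig7.stub_kerrIsometryResiduals := by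
  sorry

/-- Stub 1G-core (r6, unchanged): the source-free flat/Kerr–Schild slab junction of the recut (p125072). -/
theorem stub_recutJunctionCore : Sig7.stub_recutJunctionCore := by
  sorry

/-- Stub 1F-T2 (re-opened by the re-type): chart transfer with the ray clause and the orientation. -/
theorem stub_chartTransferT2 : Sig7.stub_chartTransferT2 := by
  sorry

/-- Stub 2 (r7, open problem, LEAD): the global half, tame immersed witness shape. -/
theorem stub_nonSettlingCure : Sig7.stub_nonSettlingCure := by
  sorry

/-- Stub 3 (XL, conjectural; statement landed in the Sig module): the Bridge. -/
theorem stub_probeUniversality : Sig.stub_probeUniversality := by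
  sorry

/-- Stub 4-residuals (r7): the cited Chruściel–Delay fact ∧ the localised Moncrief annihilator lemma (p124620). -/
theorem stub_moncriefResiduals : Sig7.stub_moncriefResiduals := by
  sorry

/-- Stub 5 (r7): the dual modes detect at a germ-KID-free point; immersed steerable families escape (T2 currency). -/
theorem stub_dualModeEjection : Sig7.stub_dualModeEjection := by
  sorry

/-! ## §3 Glue lemmas (sorry-free) -/

section Glue

variable {X : Type} [TopologicalSpace X] [ChartedSpace E3 X] [IsManifold (𝓡 3) ∞ X]
  [T2Space X] [SecondCountableTopology X] [ConnectedSpace X]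

/-- `KerrOrBomb` applied to a telescope hole which is Killing-mode-stable (instances discharged by the
tree's `hasLeviCivita` and `kerrFacts`; `isKillingModeStable_iff` bridges h6 by `Iff.rfl`). -/
theorem isKerrExterior_of_kerrOrBomb (hK : KerrOrBomb) (𝓑 : StationaryAFBlackHole.{0})
    (hreg : InTelescope 𝓑) (hms : ModeStable 𝓑) : IsKerrExterior 𝓑 := by
  haveI : 𝓑.metric.HasLeviCivita := 𝓑.metric.toPseudoRiemannianMetric.hasLeviCivita
  haveI : Kerr.Facts := kerrFacts
  obtain ⟨h1, h2, h3, h4, h5⟩ := hreg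
  exact hK 𝓑 h1 h2 h3 h4 h5 ((𝓑.isKillingModeStable_iff).mp hms)

/-- **Stub 1R from F3 ∧ F4 alone** (r7): the wave-3 reduction `stub_kerrIsometryRigidity_of_extension_and_rigidity`
(p126702) with its three cited Kerr/Schwarzschild facts DISCHARGED by the tree's proofs
(`ONeill1995_kerrKillingFields_holds`, `StephaniEtAl2003_schwarzschildKillingFields_holds` p129316,
`ONeill1995_kerrBackwardsIsometry_holds` p127724). -/
theorem kerrIsometryRigidity_of_F3_F4 (hHX : KerrHorizonExtension) (hAR : KerrAsymptoticRigidity) :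
    Sig4.stub_kerrIsometryRigidity :=
  stub_kerrIsometryRigidity_of_extension_and_rigidity ONeill1995_kerrKillingFields_holds
    StephaniEtAl2003_schwarzschildKillingFields_holds ONeill1995_kerrBackwardsIsometry_holds hHX hAR

/-- **Stub 1G from its r6 residual** (wave 3, p125072). -/
theorem recutCovering_of_core (hJC : RecutJunctionCore) : Sig4.stub_recutCovering :=
  stub_recutCovering_of_core hJC

/-- **Stub 4 from the Chruściel–Delay fact and its r6 residual** (wave 3, p124601 + p124620). -/
theorem moncriefFacts_of_fact_of_singleDetection
    (hCD : Literature.Geometry.Lorentzian.ChruscielDelay_localConstraintDeformation)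
    (hSD : ∀ (X : Type) [TopologicalSpace X] [ChartedSpace E3 X] [IsManifold (𝓡 3) ∞ X] [T2Space X]
      [SecondCountableTopology X] [ConnectedSpace X] (D : InitialDataSet (𝓡 3) X)
      (𝒟 : VacuumCauchyDevelopment D) (x₀ : X), LocalSingleDetectionAt 𝒟 x₀) : Sig.stub_moncriefFacts :=
  stub_moncriefFacts_of_facts (localConstraintDeformationAt_of_fact hCD) hSD

/-- **Moncrief transversality, corrected form, from the two facts** (the landed reduction
`stub_moncriefTransversality_of_localDeformation`, p105738, fed with `stub_moncriefFacts`). -/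
theorem moncriefTransversality_of_facts (hM : Sig.stub_moncriefFacts)
    {D : InitialDataSet (𝓡 3) X} (hD : D ∈ admissibleVacuumData X) (𝒟 : VacuumCauchyDevelopment D)
    (x₀ : X) {k : ℕ} (A B : Fin k → BilinField X) (hdet : AreSymmDetectorsAt 𝒟 x₀ A B)
    (V : Set X) (hV : IsOpen V) (hxV : x₀ ∈ V) :
    ∃ G : EuclideanSpace ℝ (Fin k) → InitialDataSet (𝓡 3) X,
      InitialDataSet.IsSmoothDataFamily k G ∧ G 0 = D ∧ (∀ c, G c ∈ admissibleVacuumData X) ∧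
      (∃ K : Set X, IsCompact K ∧ K ⊆ V ∧ K ⊆ (extChartAt (𝓡 3) x₀).source ∧
        IsSupportedIn D G K) ∧
      (pairingMatrix D x₀ A B G).det ≠ 0 :=
  stub_moncriefTransversality_of_localDeformation X D hD 𝒟 x₀ k A B hdet.2.2 hdet.1 hdet.2.1
    (hM.1 X D 𝒟 x₀) (hM.2 X D 𝒟 x₀) V hV hxV

/-- **Settling (T2 d.o.c. sense) to mode-stable regular holes ⇒ the RE-TYPED summit property**, given `KerrOrBomb`
(each limit hole is a sub-extremal Kerr exterior), the rigidity of that identification in the settling chart (stub 1R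
via F3 ∧ F4), its future-preservation (F5), the covering clauses of the recut (stub 1G), the T2 chart transfer (stub 1F-T2)
and MGHD existence. -/
theorem summitPropertyT2_of_settlesDocWithT2 (hK : KerrOrBomb) (hR : Sig4.stub_kerrIsometryRigidity)
    (hF5 : Sig7.stub_kerrIdentificationFuture) (hG : Sig4.stub_recutCovering) (hT : Sig7.stub_chartTransferT2)
    (hMGHD : Summit.FinalStateConjecture.FinalStateConjecture.Theses.SwallowTheDatum.MGHDExists)
    {D : InitialDataSet (𝓡 3) X} (hD : D ∈ admissibleVacuumData X) (h : SettlesDocWithT2 ModeStable X D) :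
    SummitPropertyT2 X D := by
  refine ⟨hMGHD X D hD, fun 𝒟 h𝒟 ↦ ?_⟩
  obtain ⟨hcni, O, d, hO, hex, hnorm, hrays, hor, hholes⟩ := h 𝒟 h𝒟
  refine ⟨hcni, ?_⟩
  have hKerr : ∀ i, ∃ (M a c r₀ : ℝ) (Θ : E4 → E4),
      IsKerrChartedWith (d.hole i) (d.adapted i) M a c r₀ Θ := fun i ↦
    hR (d.hole i) (d.adapted i) (hholes i).2.2.2.1 (hholes i).2.2.2.2.1 (hholes i).1 (hholes i).2.1
      (hholes i).2.2.1
      (isKerrExterior_of_kerrOrBomb hK (d.hole i) (hholes i).2.2.2.1 (hholes i).2.2.2.2.2)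
  choose M a c r₀ Θ hW using hKerr
  have hreg : ∀ i, (d.hole i).horizon ⊆ Set.range (d.adapted i).toFun ∧
      ChartIsAsymptoticallyCartesian (d.adapted i) ∧ InTelescope (d.hole i) := fun i ↦
    ⟨(hholes i).1, (hholes i).2.1, (hholes i).2.2.2.1⟩
  have hcov : KerrSchildRecutCovering 𝒟 d M a Θ := hG X D 𝒟 O d M a c r₀ Θ hO hex hnorm hreg hW
  have hfut : ∀ i, ∀ u ∈ (Kerr.exterior (M i) (a i) : Set E4), ∀ h : Θ i u ∈ (d.adapted i).domain,
      (d.hole i).timeOrientation.IsFutureDirected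
        (mfderiv 𝓘(ℝ, E4) (𝓡 4) (d.adapted i).toFun ⟨Θ i u, h⟩
          (fderiv ℝ (Θ i) u (Kerr.timeVector (M i) (a i) u))) :=
    fun i u hu h ↦ hF5 (d.hole i) (d.adapted i) (M i) (a i) (c i) (r₀ i) (Θ i) (hholes i).2.2.2.1 (hW i) u hu h
  obtain ⟨O', d', hsub, hO', hrays', hex', hfo'⟩ :=
    hT X D 𝒟 O d M a c r₀ Θ hO hex hnorm hW hfut hcov hrays hor
  exact ⟨O', d', hsub, hO', hrays', hex', hfo'⟩

/-- **A regularly settling datum (T2 d.o.c. sense) that does not settle to mode-stable holes carries a BOMB**: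
some MGHD, some exhaustive regular horizon-normalised T2 decomposition of its exterior, some hole which is not
Killing-mode-stable (classical logic). -/
theorem exists_bomb_docT2 {D : InitialDataSet (𝓡 3) X} (hS : SettlesDocWithT2 (fun _ ↦ True) X D)
    (hnot : ¬ SettlesDocWithT2 ModeStable X D) :
    ∃ (𝒟 : VacuumCauchyDevelopment D), 𝒟.IsMaximal ∧
      Summit.FinalStateConjecture.HasCompleteNullInfinity 𝒟.toCauchyDevelopment ∧
      ∃ (O : Set 𝒟.carrier) (d : StationaryFinalStateDecomposition 𝒟.toSpacetime O 2),
        O = Summit.FinalStateConjecture.exteriorOf 𝒟.toCauchyDevelopment d.charted ∧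
        HasExhaustiveDocCharts' d ∧ IsHorizonNormalised d ∧
        Summit.FinalStateConjecture.RaysStayInClosure 𝒟.toCauchyDevelopment
          (O ∩ 𝒟.metric.chronologicalPast 𝒟.timeOrientation (docCharted d)) ∧
        IsOrientationCompatible 𝒟 d ∧
        (∀ i, (d.hole i).horizon ⊆ Set.range (d.adapted i).toFun ∧
          ChartIsAsymptoticallyCartesian (d.adapted i) ∧
            ChartIsAsymptoticallySchwarzschildean' (d.adapted i) ∧
              InTelescope (d.hole i) ∧ (d.hole i).IsIPlusRegular) ∧
        ∃ i, ¬ ModeStable (d.hole i) := by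
  by_contra hcon
  apply hnot
  intro 𝒟 h𝒟
  obtain ⟨hcni, O, d, hO, hex, hnorm, hrays, hor, hholes⟩ := hS 𝒟 h𝒟
  refine ⟨hcni, O, d, hO, hex, hnorm, hrays, hor, fun i ↦ ⟨(hholes i).1, (hholes i).2.1, (hholes i).2.2.1,
    (hholes i).2.2.2.1, (hholes i).2.2.2.2.1, ?_⟩⟩
  by_contra hi
  exact hcon ⟨𝒟, h𝒟, hcni, O, d, hO, hex, hnorm, hrays, hor, fun j ↦ ⟨(hholes j).1, (hholes j).2.1,
    (hholes j).2.2.1, (hholes j).2.2.2.1, (hholes j).2.2.2.2.1⟩, i, hi⟩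

omit [T2Space X] [SecondCountableTopology X] [ConnectedSpace X] in
/-- **Steering curves inside a compactly supported deformation family are TAME** (the T2 glue for stub 5): if every
member of the jointly smooth curve `F` through the admissible datum `D = F 0` is a member of a family `G` supported in a
compact set `K` (`IsSupportedIn D G K`), then `F` is tame on a collared restriction of the sole end of `D`
(`isTameDataFamily_restrict_of_agree_off_compact_one`, TameFamilyOffCompact.lean). -/
theorem exists_isTameDataFamily_of_steer [T2Space X] [SecondCountableTopology X] [ConnectedSpace X]
    {D : InitialDataSet (𝓡 3) X} (hD : D ∈ admissibleVacuumData X)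
    {F : EuclideanSpace ℝ (Fin 1) → InitialDataSet (𝓡 3) X} (hF : InitialDataSet.IsSmoothDataFamily 1 F)
    (hF0 : F 0 = D) {k : ℕ} {G : EuclideanSpace ℝ (Fin k) → InitialDataSet (𝓡 3) X}
    (hFG : ∀ c, ∃ c', F c = G c') {K : Set X} (hK : IsCompact K) (hsupp : IsSupportedIn D G K) :
    ∃ e : AFEnd X, InitialDataSet.IsTameDataFamily e 1 F := by
  obtain ⟨-, e, M, hsole, hdecay⟩ := id hD
  have hR₁ : e.R < e.R + 1 := by linarith
  have hSAF : e.IsStronglyAsymptoticallyFlatDR (F 0) M := by rw [hF0]; exact hdecay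
  refine ⟨e.restrict hR₁.le, InitialDataSet.isTameDataFamily_restrict_of_agree_off_compact_one hF hsole hSAF hK
    (fun c x hx ↦ ?_) hR₁⟩
  obtain ⟨c', hc'⟩ := hFG c
  rw [hc', hF0]
  exact hsupp c' x hx

end Glue

/-! ## §4 The composition (kernel-checked; concludes the crux BY NAME over the RE-TYPED summit)

Hypotheses (r7): `MGHDExists` (item stmt-FinalStateConjecture-9937, by name) and the seven registered stub signatures of §2
(the one remaining cited Literature fact, `ChruscielDelay_localConstraintDeformation`, rides inside `stub_moncriefResiduals`). The landed chart transfer (p121011/p130371) enters through `stub_chartTransferT2`'s worker; the wave-3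
reductions (p126702, p125072, p124620/p124601) and the three discharged Kerr facts are used by name. `KerrOrBomb`, the
crux's own hypothesis, is introduced by `intro` and used three times. Case split: settles (T2 d.o.c. sense) vs not;
inside the settling case, germ-KID-free point vs none. Every branch hands a tame immersed witness, controlled on a window,
to `isTameChristodoulouGeneric_of_localWindow` (p130530). -/

/-- **`StationaryLimitReduction_of`** — the symplectic dual of the bomb, r7: the crux
`KerrOrBomb → FinalStateConjecture` (RE-TYPED summit) from the seven residual stubs, one cited fact and MGHD existence,
datum by datum. -/
theorem StationaryLimitReduction_of
    (hMGHD : Summit.FinalStateConjecture.FinalStateConjecture.Theses.SwallowTheDatum.MGHDExists)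
    (h1R : Sig7.stub_kerrIsometryResiduals) (hJC : Sig7.stub_recutJunctionCore) (hT : Sig7.stub_chartTransferT2)
    (hN : Sig7.stub_nonSettlingCure) (hP : Sig.stub_probeUniversality) (h4 : Sig7.stub_moncriefResiduals)
    (hE : Sig7.stub_dualModeEjection) :
    Summit.FinalStateConjecture.FinalStateConjecture.Theses.ZeroEnergyKerrOrBomb.StationaryLimitReduction := by
  obtain ⟨hHX, hAR, hF5⟩ := h1R
  obtain ⟨hCD, hSD⟩ := h4
  have hR : Sig4.stub_kerrIsometryRigidity := kerrIsometryRigidity_of_F3_F4 hHX hAR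
  have hG : Sig4.stub_recutCovering := recutCovering_of_core hJC
  have hM : Sig.stub_moncriefFacts := moncriefFacts_of_fact_of_singleDetection hCD hSD
  intro hK X _ _ _ _ _ _
  show InitialDataSet.IsTameChristodoulouGeneric (admissibleVacuumData X) (SummitPropertyT2 X) 1
  have good : ∀ {D' : InitialDataSet (𝓡 3) X}, D' ∈ admissibleVacuumData X →
      SettlesDocWithT2 ModeStable X D' → SummitPropertyT2 X D' := fun hD' h ↦
    summitPropertyT2_of_settlesDocWithT2 hK hR hF5 hG hT hMGHD hD' h
  refine InitialDataSet.isTameChristodoulouGeneric_of_localWindow ?_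
  intro D hD hnotP
  by_cases hS : SettlesDocWithT2 (fun _ ↦ True) X D
  · -- Case A: every MGHD of `D` settles (T2 d.o.c. sense) to regular holes; `D` being exceptional, one is a bomb
    have key : ¬ SettlesDocWithT2 ModeStable X D := fun h ↦ hnotP (good hD h)
    obtain ⟨𝒟, h𝒟, hcni, O, d, hO, hex, hnorm, hrays, hor, hreg, i, hbomb⟩ := exists_bomb_docT2 hS key
    by_cases hKID : ∃ x : X, IsKIDFreeAt 𝒟 x
    · -- Case A1: a germ-KID-free point exists — the Bridge, the dual-mode detectors, the Moncrief family
      obtain ⟨ν, ϖ, h₁, h₂, hν, hmode⟩ :=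
        hP (d.hole i) (d.adapted i) (hreg i).2.2.2.1 (hreg i).1 hbomb
      obtain ⟨x₀, k, A, B, hdet, hsteer⟩ :=
        hE X D hD 𝒟 h𝒟 hcni O d hO hex hnorm hrays hor hreg i ν ϖ h₁ h₂ hν hmode hKID
      obtain ⟨G, hGs, hG0, hGadm, ⟨K, hKc, -, hKsrc, hsupp⟩, hdetG⟩ :=
        moncriefTransversality_of_facts hM hD 𝒟 x₀ A B hdet (extChartAt (𝓡 3) x₀).source
          (isOpen_extChartAt_source x₀) (mem_extChartAt_source x₀)
      obtain ⟨ε, F, hε, hF, himm, hF0, hFG, hinj, hgood⟩ :=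
        hsteer G hGs hG0 hGadm ⟨K, hKc, hKsrc, hsupp⟩ hdetG
      have hFadm : ∀ c', F c' ∈ admissibleVacuumData X := fun c' ↦ by
        obtain ⟨c'', hc''⟩ := hFG c'
        rw [hc'']
        exact hGadm c''
      obtain ⟨e, htame⟩ := exists_isTameDataFamily_of_steer hD hF hF0 hFG hKc hsupp
      exact ⟨e, ε, F, hε, htame, himm, hF0, hinj, fun c' _ ↦ hFadm c', fun c' hc hcε ↦
        good (hFadm c') (hgood c' hc hcε)⟩
    · -- Case A2: a local Killing germ at every point — the cure stub (right disjunct)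
      push Not at hKID
      obtain ⟨e, F, htame, himm, hF0, hinj, hadm, hgood⟩ := hN X D hD (Or.inr ⟨𝒟, h𝒟, hKID⟩)
      exact ⟨e, 1, F, one_pos, htame, himm, hF0, fun c c' _ _ h ↦ hinj h, fun c' _ ↦ hadm c',
        fun c' hc _ ↦ good (hadm c') (hgood c' hc)⟩
  · -- Case B: `D` does not settle regularly: the global half cures it (left disjunct)
    obtain ⟨e, F, htame, himm, hF0, hinj, hadm, hgood⟩ := hN X D hD (Or.inl hS)
    exact ⟨e, 1, F, one_pos, htame, himm, hF0, fun c c' _ _ h ↦ hinj h, fun c' _ ↦ hadm c',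
      fun c' hc _ ↦ good (hadm c') (hgood c' hc)⟩

/-! ## §5 Negative checks (landed `Negative/` lemmas this skeleton is read against)

* `Theorems.StationaryLimitReduction.Negative.not_stationaryLimitReduction_iff` (KillShape, p72863): a kill is
  `KerrOrBomb ∧ ¬FSC`; nothing here is of that shape, and the composition USES `KerrOrBomb`.
* The re-typed summit is NOT reachable from per-datum witness families alone any more (tame families on one fixed end,
  continuous mass: the burial of SwallowTheDatum is excluded by design, p126844 / challenge upheld 21:49Z); this skeleton
  produces its witnesses from compactly supported kicks (tame by `TameFamilyOffCompact`) or takes them from stub 2. -/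

example : ¬ StationaryLimitReduction ↔ (KerrOrBomb ∧ ¬ _root_.FinalStateConjecture) :=
  Summit.FinalStateConjecture.FinalStateConjecture.Theorems.StationaryLimitReduction.Negative.not_stationaryLimitReduction_iff

end Summit.FinalStateConjecture.FinalStateConjecture.Cruxes.StationaryLimitReduction.SymplecticDualOfTheBomb

end
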